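import Literature.NumberTheory.ComplexMultiplication.EllipticUnits.KatoEllipticUnitRepresentatives
import Literature.NumberTheory.ComplexMultiplication.EllipticUnits.KatoUnitRepRubinTheta
import Literature.NumberTheory.ComplexMultiplication.EllipticUnits.RingOfIntegersPeriodLattice
import HarnessLib

/-!
# Kato's elliptic-unit representatives EXIST, from de Shalit II.2.7 + II.2.4 (iii):
# the named fact `Kato2004.sec155_exists_katoUnitRep` is a theorem of `DeShalit1987.prop27_power` and
# `DeShalit1987.prop24_iii_unit` (a print reduction)

Topic `NumberTheory/ComplexMultiplication/EllipticUnits`; namespace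
`Literature.NumberTheory.ComplexMultiplication.EllipticUnits`. Cell `bsd-print-cf2`
(`run/shared/lean/pub/bsd-print-cf2/`), width seat `bsd-line-cf2-p1-w5` g19, `--supports` crux
stmt-BirchSwinnertonDyer-20368 (`PrintCf2.SplitBadTwoRankOneOfFacts`), whose registered skeleton
`yager_twist_dictionary` v14.10 carries ALL THREE named facts as print conjuncts: `Kato2004.sec155_exists_katoUnitRep`
(conjunct 11 of the pure-cite stub `stub_prints_mlinepin_two` = route-C print leaf 23867), `DeShalit1987.prop24_iii_unit`
(same stub, and `stub_prints_katz_two`) and `DeShalit1987.prop27_power` (`stub_prints_katz_two`). THEOREMS ONLY (no `def`,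
no named fact, no instance, no `sorry`). EFFECT: the Kato conjunct is REDUNDANT given the two de Shalit prints — one
independent print hypothesis fewer for every consumer that carries all three (`…MLinePinClassClose*`, `…ClassGroupHalfOfRows*`,
`…RowTwoUnitIndex*`, `…TwistedZetaFamily`, `…TwistedKatoKummerSystem`).

PRINT. Kato, Astérisque 295 §15.5 (p. 253): "the element `_𝔞z_𝔣 := _𝔞θ_E(α) ∈ K(𝔣)^×` […] is a `𝔭`-unit for any prime ideal
`𝔭` of `O_K` which is prime to `𝔣`, and is a unit if `𝔣` has at least two prime divisors", at the rigid levels `𝔤 = pⁿ𝔣`,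
`n ≥ 1` — typed by the tree (reading (R12): `ι̂(_𝔞z_𝔤)¹² = Θ(1; ι(𝔤), 𝔞)`) as `sec155_exists_katoUnitRep`:
`∃ u ∈ O_{K(𝔤)}[1/p]^×` with `ι̂(u)¹² = Θ(1; ι(𝔤), 𝔞)`. de Shalit II.2.7: "for `(𝔞, 6𝔣) = 1`, `Θ(v; L, 𝔞)` is a `12w_𝔣`
power in `K(𝔣)^×`" (`prop27_power`); II.2.4 (iii): "`Θ(v; L, 𝔞)` is a unit if `𝔪` is not a prime power. If `𝔪 = 𝔭ⁿ`, it
is a unit outside `𝔭`" (`prop24_iii_unit`).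

THE DERIVATION (this file). At a rigid level `𝔤 = pⁿ𝔣` (`O_K^× ↪ (O_K/𝔤)^×`) the number of roots of unity `≡ 1 (mod 𝔤)`
is `w_𝔤 = 1` (`rootsOfUnityCongruentOne_eq_one_of_unitsInjectiveMod`), so II.2.7 applied to the lattice `ι(𝔤)` (a period
lattice, `exists_periodPair_mem_iff_ideal`; `𝒪_K`-multiplication and `1` a primitive `𝔤`-division point,
`isCMLattice_of_mem_iff` / `isPrimitiveDivisionPoint_one_of_mem_iff`) and an admissible twist `𝔞` (prime to `6pⁿ𝔣`,
`IsTwist.isCoprime_six_mul_katoModulus`) yields `x ∈ K(𝔤)` with `ι̂(x)¹² = Θ(1; ι(𝔤), 𝔞) ≠ 0`. It is a `p`-unit by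
II.2.4 (iii): if `𝔤` is not a prime power, `Θ^{±1}` are algebraic integers, hence so are `x^{±1}` (twelfth roots of
algebraic integers along the injective `ι̂`); if `𝔤 = 𝔭ᵐ` then `𝔭ᵐ ≤ (p)` (`n ≥ 1`), so `(p) = 𝔭ⁱ` with `i ≥ 1` (Dedekind),
`p ∈ 𝔭`, `pᵏ ∈ 𝔭ᵏ = (a)`, and `pᵏ·Θ⁻¹ = ι(b)·(ι(a)Θ⁻¹)` is integral, whence `pᵏx⁻¹` is (`(pᵏx⁻¹)¹² = p^{11k}·(pᵏΘ⁻¹)`).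

WHAT IS PROVED: `rootsOfUnityCongruentOne_eq_one_of_unitsInjectiveMod` (`w_𝔤 = 1` at a rigid `𝔤`),
`natCast_mem_of_katoModulus_eq_pow` (`pⁿ𝔣 = 𝔭ᵐ`, `n ≥ 1` ⇒ `p ∈ 𝔭`), ★ `exists_isKatoUnitRep_of_prop27_of_prop24iii`
(pointwise existence of a level-`n` representative, GIVEN II.2.7 and II.2.4 (iii)), ★★
`Kato2004.sec155_exists_katoUnitRep_of_prints : prop27_power → prop24_iii_unit → sec155_exists_katoUnitRep` (the named fact
VERBATIM). HONEST FRAMING: a reduction between published named facts (two de Shalit prints ⇒ Kato's existence sentence in the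
tree's weak typing — bare existence, no norm-compatibility); nothing here is about an elliptic curve over `ℚ`; no summit
statement is proved; BSD is not advanced.
presearch: "Kato elliptic unit twelfth root de Shalit theta 12 w_f power" → [corpus: JohnsonLeungKings2011 Prop. 3.3 (1) proof,
arXiv:0804.2828 p. 9] «`_𝔞θ_E` is a twelfth root of the function in Chapter II of [deShalit]. Property 1) follows immediately from
[deShalit] II.2.4» — the printed argument this file formalises at the level of VALUES; tree: no `_of_`/`_holds` for
`sec155_exists_katoUnitRep` (`lean search`), nearest `TwistedZeta.mem_sUnits_of_isThetaValueOne` (S-unit form of II.2.4 (iii)).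

## References
* [Kato2004Asterisque] K. Kato, *p-adic Hodge theory and values of zeta functions of modular forms*, Astérisque 295 (2004),
  §15.5 (p. 253), (15.3.1) (p. 252).
* [deShalit1987] E. de Shalit, *Iwasawa theory of elliptic curves with complex multiplication* (1987), II.2.4 Proposition (iii),
  II.2.7 Proposition, II.1.1 (`w_𝔣`).
* [JohnsonLeungKings2011] J. Johnson-Leung, G. Kings, J. reine angew. Math. 653 (2011), Prop. 3.3 (1) and its proof
  (arXiv:0804.2828 p0009).
-/

noncomputable section

open scoped Classical
open NumberField IsDedekindDomain
open Literature.NumberTheory.NumberFields (rayClassField)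
open Literature.NumberTheory.EllipticCurves (IsImaginaryQuadratic)

namespace Literature.NumberTheory.ComplexMultiplication.EllipticUnits

variable {K : Type} [Field K] [NumberField K]

/-! ## §1. Two arithmetic lemmas -/

omit [NumberField K] in
/-- **`w_𝔤 = 1` at a rigid level**: if `O_K^× → (O_K/𝔤)^×` is injective, the only root of unity `≡ 1 (mod 𝔤)` is `1`
(de Shalit's `w_𝔤`, II.1.1; the exponent `12·w_𝔤` of II.2.7 is then `12`). Same statement as the Summits-side
`PrintCf2.KatoThetaNorm.rootsOfUnityCongruentOne_eq_one` (a `Summits/…/Theorems` file, not importable from `Literature/`), re-proved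
here for Literature consumers. [cite: deShalit1987, II.1.1 and II.2.7 Proposition] -/
theorem rootsOfUnityCongruentOne_eq_one_of_unitsInjectiveMod {𝔤 : Ideal (𝓞 K)} (h : UnitsInjectiveMod 𝔤) :
    rootsOfUnityCongruentOne 𝔤 = 1 := by
  rw [rootsOfUnityCongruentOne, Nat.card_eq_one_iff_unique]
  refine ⟨⟨fun a b ↦ Subtype.ext ?_⟩, ⟨⟨1, IsOfFinOrder.one, by simp⟩⟩⟩
  have ha : a.1 = 1 := h a.1 1 (by simpa using a.2.2)
  have hb : b.1 = 1 := h b.1 1 (by simpa using b.2.2)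
  rw [ha, hb]

/-- A rational prime is not a unit of `𝓞_K` (its norm is `±p^{[K:ℚ]} ≠ ±1`); the sibling files keep this lemma private,
so it is re-proved here. [cite: NeukirchANT1999, Ch. I §2] -/
private theorem not_isUnit_natCast_of_prime {l : ℕ} (hl : l.Prime) : ¬ IsUnit ((l : ℕ) : 𝓞 K) := by
  intro hu
  have h1 : IsUnit (Algebra.norm ℤ ((l : ℕ) : 𝓞 K)) := hu.map _
  have h2 : Algebra.norm ℤ ((l : ℕ) : 𝓞 K) = (l : ℤ) ^ Module.finrank ℤ (𝓞 K) := by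
    rw [show ((l : ℕ) : 𝓞 K) = algebraMap ℤ (𝓞 K) (l : ℤ) by simp, Algebra.norm_algebraMap]
  rw [h2] at h1
  have hpos : 0 < Module.finrank ℤ (𝓞 K) := Module.finrank_pos
  rcases Int.isUnit_iff.mp h1 with h | h
  · have : (l : ℤ) ^ Module.finrank ℤ (𝓞 K) ≥ 2 ^ 1 := by
      calc (l : ℤ) ^ Module.finrank ℤ (𝓞 K) ≥ 2 ^ Module.finrank ℤ (𝓞 K) := by
            gcongr; exact_mod_cast hl.two_le
        _ ≥ 2 ^ 1 := pow_le_pow_right₀ (by norm_num) hpos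
    omega
  · have : (0 : ℤ) ≤ (l : ℤ) ^ Module.finrank ℤ (𝓞 K) := by positivity
    omega

/-- **If `pⁿ𝔣 = 𝔭ᵐ` with `n ≥ 1` and `𝔭` a non-zero prime, then `p ∈ 𝔭`**: `𝔭ᵐ ≤ (p)`, so `(p) ∣ 𝔭ᵐ` and `(p) = 𝔭ⁱ`
with `i ≥ 1` in the Dedekind domain `𝓞 K` (JLK Prop. 3.3 (1): "`ζ_{𝔭ⁿ} ∈ 𝒪_{K(𝔭ⁿ)}[1/𝔭]^*` if `p^r𝔪` is a power of `𝔭`" —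
such a `𝔭` lies over `p`). [cite: JohnsonLeungKings2011, Prop. 3.3 (1) (arXiv p0009)] -/
theorem natCast_mem_of_katoModulus_eq_pow {p : ℕ} [Fact p.Prime] {𝔣 𝔭 : Ideal (𝓞 K)} {n m : ℕ} (hn : 1 ≤ n)
    (h𝔭0 : 𝔭 ≠ ⊥) (h𝔭 : 𝔭.IsPrime) (heq : katoModulus p 𝔣 n = 𝔭 ^ m) : ((p : ℕ) : 𝓞 K) ∈ 𝔭 := by
  have hle : 𝔭 ^ m ≤ Ideal.span {((p : ℕ) : 𝓞 K)} :=
    heq ▸ (katoModulus_le_span_pow p 𝔣 n).trans (Ideal.pow_le_self (by omega))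
  have hdvd : Ideal.span {((p : ℕ) : 𝓞 K)} ∣ 𝔭 ^ m := Ideal.dvd_iff_le.mpr hle
  obtain ⟨i, -, hassoc⟩ := (dvd_prime_pow (Ideal.prime_of_isPrime h𝔭0 h𝔭) _).mp hdvd
  have hi : Ideal.span {((p : ℕ) : 𝓞 K)} = 𝔭 ^ i := associated_iff_eq.mp hassoc
  have hi0 : i ≠ 0 := by
    rintro rfl
    rw [pow_zero, Ideal.one_eq_top, Ideal.span_singleton_eq_top] at hi
    exact not_isUnit_natCast_of_prime (K := K) (Fact.out : p.Prime) hi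
  exact Ideal.pow_le_self hi0 (hi ▸ Ideal.mem_span_singleton_self _)

/-! ## §2. Kato's representative from II.2.7 + II.2.4 (iii) -/

/-- ★ **A level-`n` representative of Kato's `_𝔞z_{pⁿ𝔣}` EXISTS, GIVEN de Shalit II.2.7 and II.2.4 (iii).** `K` imaginary
quadratic, `ι : K → ℂ`, `p` prime, `𝔣 ≠ 0`, `n ≥ 1` with `O_K^× ↪ (O_K/pⁿ𝔣)^×`, `𝔞` an admissible twist (prime to `6p𝔣`,
`≠ O_K`): there is `u ∈ O_{K(pⁿ𝔣)}[1/p]^×` with `ι̂(u)¹² = Θ(1; ι(pⁿ𝔣), 𝔞)` (`IsKatoUnitRep`). The twelfth root is II.2.7's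
(`w_{pⁿ𝔣} = 1`); the `p`-unit property is II.2.4 (iii) (unit if `pⁿ𝔣` is not a prime power; if `pⁿ𝔣 = 𝔭ᵐ` then `𝔭 ∣ p`
and `pᵏu⁻¹` is integral for `(a) = 𝔭ᵏ` with `ι(a)Θ⁻¹` integral). [cite: Kato2004Asterisque, §15.5 (p. 253)]
[cite: deShalit1987, II.2.7 Proposition and II.2.4 Proposition (iii)] [cite: JohnsonLeungKings2011, Prop. 3.3 (1) and its proof (arXiv p0009)] -/
theorem exists_isKatoUnitRep_of_prop27_of_prop24iii (h27 : DeShalit1987.prop27_power)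
    (h24iii : DeShalit1987.prop24_iii_unit) (hK : IsImaginaryQuadratic K) (ι : K →+* ℂ) {p : ℕ} [Fact p.Prime]
    {𝔣 : Ideal (𝓞 K)} (h𝔣 : 𝔣 ≠ ⊥) {n : ℕ} (hn : 1 ≤ n) (hrig : UnitsInjectiveMod (katoModulus p 𝔣 n))
    {𝔞 : Ideal (𝓞 K)} (h𝔞 : IsTwist p 𝔣 𝔞) :
    ∃ u : (AlgebraicClosure K)ˣ, IsKatoUnitRep p ι 𝔣 n 𝔞 u := by
  -- the modulus `𝔤 = pⁿ𝔣`
  have h𝔤0 : katoModulus p 𝔣 n ≠ ⊥ := katoModulus_ne_bot p 𝔣 h𝔣 n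
  have h𝔤1 : katoModulus p 𝔣 n ≠ ⊤ := katoModulus_ne_top p 𝔣 hn
  have h𝔞𝔤 : IsCoprime 𝔞 (katoModulus p 𝔣 n) := h𝔞.isCoprime_katoModulus p 𝔣 n
  have h𝔞6 : IsCoprime 𝔞 (Ideal.span {(6 : 𝓞 K)} * katoModulus p 𝔣 n) := h𝔞.isCoprime_six_mul_katoModulus p 𝔣 n
  have h𝔞0 : 𝔞 ≠ ⊥ := ne_bot_of_isCoprime_katoModulus p 𝔣 (h𝔞.isCoprime_katoModulus p 𝔣 1)
  -- the lattices `ι(𝔤)`, `𝔞⁻¹ι(𝔤)` and representatives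
  obtain ⟨P, hP⟩ := exists_periodPair_mem_iff_ideal hK ι h𝔤0
  have hPcm : IsCMLattice ι P.lattice := isCMLattice_of_mem_iff hP
  have hprim : IsPrimitiveDivisionPoint ι (katoModulus p 𝔣 n) P.lattice 1 := isPrimitiveDivisionPoint_one_of_mem_iff hP
  obtain ⟨Pa, hPa⟩ := exists_periodPair_lattice_eq_idealInvLattice hPcm h𝔞0
  obtain ⟨T, hT⟩ := PeriodPair.IsLatticeReps.exists (L := P) (L' := Pa) (by rw [hPa]; exact le_idealInvLattice hPcm 𝔞)
  -- II.2.7: a twelfth root `x ∈ K(𝔤)` of `Θ(1; ι(𝔤), 𝔞)` (`w_𝔤 = 1`)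
  obtain ⟨x, hxF, hx⟩ := h27 K hK ι P Pa T (katoModulus p 𝔣 n) 𝔞 1 hPcm h𝔤0 h𝔤1 hprim h𝔞0 h𝔞6 hPa hT
  rw [rootsOfUnityCongruentOne_eq_one_of_unitsInjectiveMod hrig, mul_one] at hx
  have hΘ0 : P.deShalitTheta Pa T 1 ≠ 0 :=
    PeriodPair.deShalitTheta_ne_zero hT (by rw [hPa]; exact one_notMem_idealInvLattice_of_isCoprime hP h𝔤1 h𝔞𝔤)
  have hx0 : x ≠ 0 := by
    rintro rfl
    rw [map_zero, zero_pow (by norm_num)] at hx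
    exact hΘ0 hx.symm
  refine ⟨Units.mk0 x hx0, ?_, P, Pa, T, hP, hPa, hT, by rw [Units.val_mk0, map_pow, hx]⟩
  -- II.2.4 (iii): `x` is a `p`-unit
  have h := h24iii K hK ι P Pa T (katoModulus p 𝔣 n) 𝔞 1 hPcm h𝔤0 h𝔤1 hprim h𝔞0 h𝔞𝔤 hPa hT
  -- integrality transfers along the injective `ι̂`
  have tr : ∀ z : AlgebraicClosure K, IsIntegral ℤ (algClosureEmb ι z) → IsIntegral ℤ z := fun z hz ↦
    (isIntegral_algHom_iff (algClosureEmb ι).toIntAlgHom (algClosureEmb ι).injective).mp hz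
  have h12 : (0 : ℕ) < 12 := by norm_num
  have hpC : IsIntegral ℤ (p : ℂ) := by
    simpa using isIntegral_algebraMap (R := ℤ) (A := ℂ) (x := (p : ℤ))
  have hpA : IsIntegral ℤ (p : AlgebraicClosure K) := by
    simpa using isIntegral_algebraMap (R := ℤ) (A := AlgebraicClosure K) (x := (p : ℤ))
  have hinv : ((Units.mk0 x hx0)⁻¹ : (AlgebraicClosure K)ˣ).val = x⁻¹ := by
    rw [Units.val_inv_eq_inv_val, Units.val_mk0]
  refine (mem_pUnitsOf_iff p _ _).mpr ⟨by simpa only [Units.val_mk0] using hxF, ?_⟩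
  rw [hinv, Units.val_mk0]
  by_cases hpp : ∃ (𝔭 : Ideal (𝓞 K)) (m : ℕ), 𝔭.IsPrime ∧ katoModulus p 𝔣 n = 𝔭 ^ m
  · -- `𝔤 = 𝔭ᵐ`: `p ∈ 𝔭`, `pᵏ ∈ (a) = 𝔭ᵏ`, `pᵏΘ⁻¹` integral
    obtain ⟨𝔭, m, h𝔭, h𝔤eq⟩ := hpp
    have h𝔭0 : 𝔭 ≠ ⊥ := by
      rintro rfl
      rcases m with _ | m
      · exact h𝔤1 (by rw [h𝔤eq, pow_zero, Ideal.one_eq_top])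
      · exact h𝔤0 (by rw [h𝔤eq, ← Ideal.zero_eq_bot, zero_pow (Nat.succ_ne_zero m)])
    obtain ⟨hint, k, a, ha, hint'⟩ := h.2 𝔭 m h𝔭0 h𝔭 h𝔤eq
    have hp𝔭 : ((p : ℕ) : 𝓞 K) ∈ 𝔭 := natCast_mem_of_katoModulus_eq_pow hn h𝔭0 h𝔭 h𝔤eq
    have hpk : ((p : ℕ) : 𝓞 K) ^ k ∈ Ideal.span {a} := ha ▸ Ideal.pow_mem_pow hp𝔭 k
    obtain ⟨b, hb⟩ := Ideal.mem_span_singleton'.mp hpk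
    have hb' : ((b : 𝓞 K) : K) * ((a : 𝓞 K) : K) = (p : K) ^ k := by exact_mod_cast hb
    have hpk' : (p : ℂ) ^ k = ι ((b : 𝓞 K) : K) * ι ((a : 𝓞 K) : K) := by
      rw [← map_mul, hb', map_pow, map_natCast]
    -- `pᵏ·Θ⁻¹` is an algebraic integer
    have hI1 : IsIntegral ℤ ((p : ℂ) ^ k * (P.deShalitTheta Pa T 1)⁻¹) := by
      rw [hpk', mul_assoc]
      exact (map_isIntegral_int ι (RingOfIntegers.isIntegral_coe b)).mul hint'
    refine ⟨k, ?_, ?_⟩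
    · exact (hpA.pow k).mul (tr _ (IsIntegral.of_pow h12 (by rw [hx]; exact hint)))
    · refine tr _ (IsIntegral.of_pow h12 ?_)
      have e : algClosureEmb ι ((p : AlgebraicClosure K) ^ k * x⁻¹) ^ 12 =
          (p : ℂ) ^ (11 * k) * ((p : ℂ) ^ k * (P.deShalitTheta Pa T 1)⁻¹) := by
        rw [map_mul, map_pow, map_natCast, map_inv₀, mul_pow, inv_pow, hx, ← pow_mul, ← mul_assoc, ← pow_add]
        congr 2
        ring
      rw [e]
      exact (hpC.pow _).mul hI1
  · -- `𝔤` is not a prime power: `Θ` is a unit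
    obtain ⟨hint, hint'⟩ := h.1 hpp
    refine ⟨0, ?_, ?_⟩
    · rw [pow_zero, one_mul]
      exact tr _ (IsIntegral.of_pow h12 (by rw [hx]; exact hint))
    · rw [pow_zero, one_mul]
      exact tr _ (IsIntegral.of_pow h12 (by rw [map_inv₀, inv_pow, hx]; exact hint'))

/-- ★★ **PRINT REDUCTION: `Kato2004.sec155_exists_katoUnitRep` FROM `DeShalit1987.prop27_power` AND
`DeShalit1987.prop24_iii_unit`** — the named fact VERBATIM (Kato §15.5, p. 253: existence of the standard elliptic unit
`_𝔞z_{pⁿ𝔣} ∈ O_{K(pⁿ𝔣)}[1/p]^×` with twelfth power `Θ(1; pⁿ𝔣, 𝔞)`, `n ≥ 1`, rigid level, admissible twist) follows from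
de Shalit II.2.7 (the `12w_𝔣`-th root in `K(𝔣)`) and II.2.4 (iii) (unit / `𝔭`-unit). Consumers carrying all three prints may
discharge `hE` by `sec155_exists_katoUnitRep_of_prints h27 h24iii`. [cite: Kato2004Asterisque, §15.5 (p. 253)]
[cite: deShalit1987, II.2.7 Proposition and II.2.4 Proposition (iii)] [cite: JohnsonLeungKings2011, Prop. 3.3 (1) and its proof (arXiv p0009)] -/
theorem Kato2004.sec155_exists_katoUnitRep_of_prints (h27 : DeShalit1987.prop27_power)
    (h24iii : DeShalit1987.prop24_iii_unit) : Kato2004.sec155_exists_katoUnitRep :=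
  fun _K _ _ hK ι _p _ _𝔣 h𝔣 _n hn hrig _𝔞 h𝔞 ↦
    exists_isKatoUnitRep_of_prop27_of_prop24iii h27 h24iii hK ι h𝔣 hn hrig h𝔞

end Literature.NumberTheory.ComplexMultiplication.EllipticUnits

end
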